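import Literature.MathematicalPhysics.QuantumFieldTheory.Balaban1983to89.B5Pieces133Torus
import Literature.MathematicalPhysics.QuantumFieldTheory.Balaban1983to89.B5TorusCover
import Literature.MathematicalPhysics.QuantumFieldTheory.Balaban1983to89.B5Prop12GpTorus
import Literature.MathematicalPhysics.QuantumFieldTheory.Balaban1983to89.B6Prop22OneScaleTorus

/-!
# `Balaban1983to89.B5Display133G0Torus` — the (1.133)-transfer G′ ↝ G₀ INSTANCED on Bałaban's tori: the carrier
# `B5Transfer133.Carrier133` between the G′-setting `gpSetting` and the G₀-setting `g0Setting` (σ = ι = κ = id), its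
# `CarrierFacts`, the entrywise display `Display133` and the row sums `URow` PROVED, hence the hypothesis `transfer` of
# S3 DISCHARGED: Proposition 1.2 for G₀ on the torus from «Proposition 1.1 for G₀» and «(1.114) for G₀» alone

statement-level skeleton of published theorems with citation tags; proofs where landed; nothing here is a claim
about the Yang–Mills mass gap

Source (lit-balaban / pub-balaban cells): T. Bałaban, *Propagators and renormalization transformations for lattice
gauge theories. I*, Commun. Math. Phys. **95** (1984) 17–40 [`Balaban1984PropagatorsI`, "B5"], p. 39 [PDF 23]
((1.132)–(1.134)), pp. 35–36 [PDF 19–20] (Prop. 1.2, (1.108)–(1.114)); held as `paper:balaban1984-cmp95-propagators-rt-i`.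

## WHAT IS PRINTED (verbatim, p. 39)

«We will prove (1.115)–(1.117), and in fact the whole Proposition 1.2, for the operator G₀. … Properties of the
operator G₀ can be easily reduced to the corresponding properties of the operator G′ by the equality
G₀ = G′ + G′(a_kQ′*Q′ − aQ*Q)G₀. (1.133) We only have to know some weak bounds for G₀, for example bounds in the L²-norm
(1.89), or (1.114). … we have Proposition 1.1 for G₀. This leads also to (1.114) by the same reasoning with a random
walk expansion as for G. In paper [2] we have proved all the necessary properties of G′, except the second order
inequalities (1.112), (1.113).»

## WHAT THIS MODULE PROVES (kernel-checked, zero sorry)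

The tree's S3 chain ends in `B5Prop12GpTorus.prop12G0_of_torusGp'`: Prop. 1.2 for a family famG0 from (1.110)–(1.113)
for G′ (PROVED there for `gpSetting`), «Prop. 1.1 for G₀» (`h11G0`), «(1.114) for G₀» (`h114G0`) and the located
hypothesis `transfer` («easily reduced … by the equality (1.133)»), which `B5Transfer133.transfer_of_display133` derives
from the located leaves `CarrierFacts`, `Display133`, `URow` of a `Carrier133`.  Here, for the concrete pair
(`gpSetting P a m² k o`, `g0Setting P a m² k μ`) on ONE torus and one direction μ (1 ≤ k ≤ m + K, a > 0, m² ≥ 0):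
§1 THE LATTICE MEAN-VALUE INEQUALITY on the fine torus: |u(x′) − u(x)| ≤ d·|x − x′|·sup|∇^ηu| over the coordinate box
   between x and x′ (`abs_sub_le_T_mul`: coordinate-by-coordinate paths along the shorter arcs, `InBox`);
§2 the Hölder seminorm (1.109) is subadditive (`holN_add_le`, `holN_sum_le`) and THE PRODUCT RULE WITH THE MEAN VALUE
   STEP: ‖ζu‖_α ≤ (‖ζ‖_α + |ζ|)·(M₀ + d·M₁) for supp ζ ⊂ Δ̃(y), α ≤ 1, |u| ≤ M₀ and |∇^ηu| ≤ M₁ within 3 of y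
   (`holN_cut_mul_le`);
§3 the torus chart of T₁^{(k)} (`chartT`), neighbourhood and cube cardinalities (`blk_fine` reused from `B6Prop22OneScaleTorus`), ‖J‖ ≤ d·3^d·|J| for supp J ⊂ Δ̃(y′);
§4 THE CARRIER `carrier` (σ = ι = κ = id, T₁ = the whole unit lattice, nbr = radius-6 neighbourhoods, ζ_w = 1_{Δ̃(w)},
   pieces 1_{B(y″)}V(G₀J)_ν and 1_{B(y″)}V(G₀∇*J)), `carrierFacts` (A = 2a, B = d·3^d, r0 = 6, Nn = 13^d — `B5Pieces133Torus`),
   `uRow` (Λ = K_d(κ), `B5TorusCover`);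
§5 `display133` (Dh = d + 1): the four clauses of `Display133` from (1.133) with the cube decomposition
   (`B5Pieces133Torus.DG0E_apply_pieces`), subadditivity of sup and Hölder norms, and §2 for ‖ζG′(piece′)‖_α;
§6 `transfer_torus` = `transfer_of_display133` instanced, and **`prop12G0_torus`**: `B5.Prop12Printed famG0` for the
   G₀-family of record from `h11G0 : B5.Prop11Printed famG0` and `h114G0 : Prop11Printed famG0 → Local114Fam famG0` ALONE.
HONEST SCOPE: per-direction scalar reading of G₀ (module docstrings of `B5Eq133G0Torus`, `B5G0SettingTorus`, incl.
DIVERGENCE T on the exponent range of h1 and the vacuous sixth L² members); U = 1; tori of `Setup` with P.d = d fixed in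
a family; constants explicit, not optimised.  The two printed sentences «we have Proposition 1.1 for G₀» and «This leads
also to (1.114) …» remain the named hypotheses they are (r02's matrix-side `B5Prop11G0Torus` + bridge).  CELL
BOOK-KEEPING: row B5.Prop1.2 census (vii) of ROWS-B5 (owner r02, referee ref-4); VALUE = the located «easily reduced … by
the equality (1.133)» is now a theorem for Bałaban's operators on the torus, NOT summit progress.
-/

namespace Literature.MathematicalPhysics.QuantumFieldTheory.Balaban1983to89

open Matrix

noncomputable section

namespace B5Display133G0Torus

open B1RG242Torus B5Ineq137Torus B5GpSettingTorus B5Eq133G0Torus B5G0SettingTorus B5Display136Torus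
  B5Display135Torus B5Pieces133Torus B5FromB4
open B4TorusKernel.MultiPeriod (circAbs circAbs_nonneg circAbs_le_abs circAbs_add_mul)

variable {P : Params}

/-! ## §1 The lattice mean-value inequality on the fine torus -/

/-- The circular coordinate distance `dist(a − b, Nℤ)` of two residues (as an integer ≥ 0). [folklore] -/
def cd (N : ℕ) (a b : ZMod N) : ℤ := circAbs N ((a.val : ℤ) - (b.val : ℤ))

/-- `cd a a = 0`. [folklore] -/
private theorem cd_self (N : ℕ) (a : ZMod N) : cd N a a = 0 := by
  rw [cd, sub_self, B4Sect5Torus.circAbs_zero]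

/-- `cd` is symmetric. [folklore] -/
private theorem cd_comm {N : ℕ} (hN : 1 ≤ N) (a b : ZMod N) : cd N a b = cd N b a := by
  rw [cd, cd, ← B4Sect5Torus.circAbs_neg hN, neg_sub]

/-- `0 ≤ cd`. [folklore] -/
private theorem cd_nonneg {N : ℕ} (hN : 1 ≤ N) (a b : ZMod N) : 0 ≤ cd N a b := circAbs_nonneg hN _

/-- Translating a residue by an integer z moves it by `dist(z, Nℤ)`. [folklore] -/
private theorem cd_add_intCast {N : ℕ} [NeZero N] (a : ZMod N) (z : ℤ) : cd N (a + (z : ZMod N)) a = circAbs N z := by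
  have hd : (N : ℤ) ∣ (((a + (z : ZMod N)).val : ℤ) - (a.val : ℤ) - z) := by
    rw [← ZMod.intCast_zmod_eq_zero_iff_dvd]
    push_cast
    rw [ZMod.natCast_zmod_val, ZMod.natCast_zmod_val]
    ring
  obtain ⟨m, hm⟩ := hd
  rw [cd, show ((a + (z : ZMod N)).val : ℤ) - (a.val : ℤ) = z + N * m by linarith, circAbs_add_mul]

/-- **The shorter arc**: b = a ± dist(b − a, Nℤ). [folklore] -/
private theorem exists_sign {N : ℕ} [NeZero N] (a b : ZMod N) :
    ∃ s : ℤ, (s = 1 ∨ s = -1) ∧ b = a + ((s * cd N b a : ℤ) : ZMod N) := by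
  set r := (((b.val : ℤ) - (a.val : ℤ)) % (N : ℤ)) with hr
  have hab : (((b.val : ℤ) - (a.val : ℤ) : ℤ) : ZMod N) = b - a := by
    push_cast; rw [ZMod.natCast_zmod_val, ZMod.natCast_zmod_val]
  have hrz : ((r : ℤ) : ZMod N) = b - a := by rw [hr, ZMod.intCast_mod, hab]
  unfold cd circAbs
  rcases le_total r ((N : ℤ) - r) with h | h
  · refine ⟨1, Or.inl rfl, ?_⟩
    rw [← hr, min_eq_left h, one_mul, hrz]; ring
  · refine ⟨-1, Or.inr rfl, ?_⟩
    rw [← hr, min_eq_right h, show (-1 : ℤ) * ((N : ℤ) - r) = r + N * (-1) by ring]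
    push_cast
    rw [hrz, ZMod.natCast_self]; ring

/-- **The coordinate box between x and x′**: every coordinate of z is (circularly) no farther from x than x′'s (the lattice
paths realising the sup distance |x − x′| of (1.109) live here). [cite: Balaban1984PropagatorsI, (1.109) p.35] -/
def InBox (x x' z : Site P 0) : Prop := ∀ ν, cd _ (z ν) (x ν) ≤ cd _ (x' ν) (x ν)

/-- x′ is in the box. [folklore] -/
private theorem inBox_right (x x' : Site P 0) : InBox x x' x' := fun _ => le_rfl

/-- **Points of the box are no farther from x than x′** (sup torus distance |x − x′| of (1.109)). [cite: Balaban1984PropagatorsI, (1.109) p.35] -/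
theorem T_le_of_inBox {x x' z : Site P 0} (hz : InBox x x' z) : T P 0 x z ≤ T P 0 x x' := by
  have hN : 1 ≤ P.sitesPerDir 0 := (P.one_lt_sitesPerDir 0).le
  unfold T B4Sect5Torus.tdist
  have hs : Finset.univ.sup (B4Sect5Torus.ccoord (Nv P 0) (toT x) (toT z)) ≤
      Finset.univ.sup (B4Sect5Torus.ccoord (Nv P 0) (toT x) (toT x')) := by
    refine Finset.sup_le fun ν _ => le_trans ?_ (Finset.le_sup (Finset.mem_univ ν))
    unfold B4Sect5Torus.ccoord
    apply Int.toNat_le_toNat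
    have h := hz ν
    rw [cd_comm hN, cd_comm hN (x' ν)] at h
    exact h
  exact_mod_cast hs

/-- Each coordinate distance is at most the sup distance. [folklore] -/
private theorem cd_le_T (x x' : Site P 0) (ν : Fin P.d) : (cd _ (x' ν) (x ν) : ℝ) ≤ T P 0 x x' := by
  have hN : 1 ≤ P.sitesPerDir 0 := (P.one_lt_sitesPerDir 0).le
  rw [cd_comm hN]
  exact B4Sect5Torus.circAbs_le_tdist (Nv_pos P 0) (toT x) (toT x') ν

/-- The t-th point of the straight path from z in direction ±e_μ. [folklore] -/
def linePt (z : Site P 0) (μ : Fin P.d) (s : ℤ) (t : ℕ) : Site P 0 :=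
  Function.update z μ (z μ + ((s * t : ℤ) : ZMod (P.sitesPerDir 0)))

/-- The path starts at z. [folklore] -/
private theorem linePt_zero (z : Site P 0) (μ : Fin P.d) (s : ℤ) : linePt z μ s 0 = z := by
  simp [linePt]

/-- Forward paths advance by unit shifts. [folklore] -/
private theorem linePt_succ_pos (z : Site P 0) (μ : Fin P.d) (t : ℕ) :
    linePt z μ 1 (t + 1) = Site.shift (linePt z μ 1 t) μ := by
  simp only [linePt, Site.shift, Function.update_idem, Function.update_self, one_mul]
  congr 1; push_cast; ring

/-- Backward paths retreat by unit shifts. [folklore] -/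
private theorem linePt_succ_neg (z : Site P 0) (μ : Fin P.d) (t : ℕ) :
    linePt z μ (-1) t = Site.shift (linePt z μ (-1) (t + 1)) μ := by
  simp only [linePt, Site.shift, Function.update_idem, Function.update_self]
  congr 1; push_cast; ring

/-- Path points stay in the box. [folklore] -/
private theorem inBox_linePt {x x' z : Site P 0} (hz : InBox x x' z) {μ : Fin P.d} (hzμ : z μ = x μ) {s : ℤ}
    (hs : s = 1 ∨ s = -1) {t : ℕ} (ht : (t : ℤ) ≤ cd _ (x' μ) (x μ)) : InBox x x' (linePt z μ s t) := by
  intro ν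
  by_cases hν : ν = μ
  · subst hν
    rw [linePt, Function.update_self, hzμ, cd_add_intCast]
    have hN : 1 ≤ P.sitesPerDir 0 := (P.one_lt_sitesPerDir 0).le
    calc circAbs (P.sitesPerDir 0) (s * t) ≤ |s * (t : ℤ)| := circAbs_le_abs hN _
      _ = t := by rcases hs with h | h <;> simp [h]
      _ ≤ _ := ht
  · rw [linePt, Function.update_of_ne hν]
    exact hz ν

/-- Telescoping along one coordinate path. [folklore] -/
private theorem abs_sub_line_le {x x' z : Site P 0} (u : Site P 0 → ℝ) {B : ℝ}
    (hB : ∀ w, InBox x x' w → ∀ μ, |u (Site.shift w μ) - u w| ≤ B) (hz : InBox x x' z) {μ : Fin P.d}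
    (hzμ : z μ = x μ) {s : ℤ} (hs : s = 1 ∨ s = -1) :
    ∀ t : ℕ, (t : ℤ) ≤ cd _ (x' μ) (x μ) → |u (linePt z μ s t) - u z| ≤ t * B := by
  intro t
  induction t with
  | zero => intro _; rw [linePt_zero, sub_self, abs_zero, Nat.cast_zero, zero_mul]
  | succ t ih =>
    intro ht
    have ht' : (t : ℤ) ≤ cd _ (x' μ) (x μ) := by push_cast at ht; linarith
    have hstep : |u (linePt z μ s (t + 1)) - u (linePt z μ s t)| ≤ B := by
      rcases hs with h | h
      · subst h
        rw [linePt_succ_pos]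
        exact hB _ (inBox_linePt hz hzμ (Or.inl rfl) ht') μ
      · subst h
        rw [abs_sub_comm, linePt_succ_neg z μ t]
        exact hB _ (inBox_linePt hz hzμ (Or.inr rfl) ht) μ
    calc |u (linePt z μ s (t + 1)) - u z|
        = |(u (linePt z μ s (t + 1)) - u (linePt z μ s t)) + (u (linePt z μ s t) - u z)| := by ring_nf
      _ ≤ |u (linePt z μ s (t + 1)) - u (linePt z μ s t)| + |u (linePt z μ s t) - u z| := abs_add_le _ _
      _ ≤ B + t * B := add_le_add hstep (ih ht')
      _ = ((t + 1 : ℕ) : ℝ) * B := by push_cast; ring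

/-- The hybrid point: x′ on the coordinates in S, x elsewhere. [folklore] -/
def mix (x x' : Site P 0) (S : Finset (Fin P.d)) : Site P 0 := fun ν => if ν ∈ S then x' ν else x ν

/-- Hybrid points lie in the box. [folklore] -/
private theorem inBox_mix (x x' : Site P 0) (S : Finset (Fin P.d)) : InBox x x' (mix x x' S) := by
  intro ν
  have hN : 1 ≤ P.sitesPerDir 0 := (P.one_lt_sitesPerDir 0).le
  unfold mix
  split_ifs
  · exact le_rfl
  · rw [cd_self]; exact cd_nonneg hN _ _

/-- Telescoping over the coordinates. [folklore] -/
private theorem abs_sub_mix_le {x x' : Site P 0} (u : Site P 0 → ℝ) {B : ℝ}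
    (hB : ∀ w, InBox x x' w → ∀ μ, |u (Site.shift w μ) - u w| ≤ B) (S : Finset (Fin P.d)) :
    |u (mix x x' S) - u x| ≤ (∑ μ ∈ S, (cd _ (x' μ) (x μ) : ℝ)) * B := by
  classical
  induction S using Finset.induction_on with
  | empty =>
    have : mix x x' ∅ = x := funext fun ν => by simp [mix]
    rw [this, sub_self, abs_zero, Finset.sum_empty, zero_mul]
  | @insert μ S hμ ih =>
    have hN : 1 ≤ P.sitesPerDir 0 := (P.one_lt_sitesPerDir 0).le
    obtain ⟨s, hs, hx'⟩ := exists_sign (x μ) (x' μ)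
    set c := cd _ (x' μ) (x μ) with hc
    have hc0 : 0 ≤ c := cd_nonneg hN _ _
    have hzμ : mix x x' S μ = x μ := by simp [mix, hμ]
    -- the new hybrid point is the end of the coordinate path from the old one
    have hend : mix x x' (insert μ S) = linePt (mix x x' S) μ s c.toNat := by
      funext ν
      by_cases hν : ν = μ
      · subst hν
        rw [linePt, Function.update_self, hzμ, Int.toNat_of_nonneg hc0]
        simp only [mix, Finset.mem_insert, true_or, if_true]
        exact hx'
      · rw [linePt, Function.update_of_ne hν]
        simp [mix, Finset.mem_insert, hν]
    have hline := abs_sub_line_le u hB (inBox_mix x x' S) hzμ hs c.toNat (by rw [Int.toNat_of_nonneg hc0])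
    have hcast : ((c.toNat : ℕ) : ℝ) = (c : ℝ) := by exact_mod_cast Int.toNat_of_nonneg hc0
    rw [Finset.sum_insert hμ, add_mul]
    calc |u (mix x x' (insert μ S)) - u x|
        = |(u (mix x x' (insert μ S)) - u (mix x x' S)) + (u (mix x x' S) - u x)| := by ring_nf
      _ ≤ |u (mix x x' (insert μ S)) - u (mix x x' S)| + |u (mix x x' S) - u x| := abs_add_le _ _
      _ ≤ (c : ℝ) * B + (∑ ν ∈ S, (cd _ (x' ν) (x ν) : ℝ)) * B := by
          refine add_le_add ?_ ih
          rw [hend, ← hcast]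
          exact hline

/-- **THE LATTICE MEAN-VALUE INEQUALITY**: if every unit forward difference of u on the coordinate box between x and x′ is
at most B in absolute value, then |u(x′) − u(x)| ≤ d·|x − x′|·B (|x − x′| the sup torus distance in fine steps; a path
of Σ_ν dist_ν ≤ d·|x − x′| unit steps inside the box) — the step behind «easily reduced» for the Hölder entry (1.111).
[cite: Balaban1984PropagatorsI, (1.109), (1.111) p.35, (1.133) p.39] -/
theorem abs_sub_le_T_mul {x x' : Site P 0} (u : Site P 0 → ℝ) {B : ℝ} (hB0 : 0 ≤ B)
    (hB : ∀ w, InBox x x' w → ∀ μ, |u (Site.shift w μ) - u w| ≤ B) :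
    |u x' - u x| ≤ P.d * T P 0 x x' * B := by
  classical
  have h := abs_sub_mix_le u hB Finset.univ
  have hmix : mix x x' Finset.univ = x' := funext fun ν => by simp [mix]
  rw [hmix] at h
  refine h.trans (mul_le_mul_of_nonneg_right ?_ hB0)
  calc ∑ μ : Fin P.d, (cd _ (x' μ) (x μ) : ℝ) ≤ ∑ _μ : Fin P.d, T P 0 x x' :=
        Finset.sum_le_sum fun ν _ => cd_le_T x x' ν
    _ = P.d * T P 0 x x' := by rw [Finset.sum_const, Finset.card_univ, Fintype.card_fin, nsmul_eq_mul]

/-! ## §2 The Hölder seminorm (1.109): subadditivity, and the product rule with the mean-value step -/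

/-- ‖0‖_α = 0. [cite: Balaban1984PropagatorsI, (1.109) p.35] -/
theorem holN_zero (k : ℕ) (α : ℝ) : holN P k α (fun _ => (0 : ℝ)) = 0 := by
  refine le_antisymm (Finset.sup'_le _ _ fun p _ => ?_) (holN_nonneg P k α _)
  simp

/-- **The Hölder seminorm is subadditive**: ‖f + g‖_α ≤ ‖f‖_α + ‖g‖_α. [cite: Balaban1984PropagatorsI, (1.109) p.35] -/
theorem holN_add_le (k : ℕ) (α : ℝ) (f g : Site P 0 → ℝ) :
    holN P k α (fun x => f x + g x) ≤ holN P k α f + holN P k α g := by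
  refine Finset.sup'_le _ _ fun p _ => ?_
  have hf := Finset.le_sup' (fun p : Site P 0 × Site P 0 =>
      if distX P k p.1 p.2 ≤ 1 then |f p.2 - f p.1| / distX P k p.1 p.2 ^ α else 0) (Finset.mem_univ p)
  have hg := Finset.le_sup' (fun p : Site P 0 × Site P 0 =>
      if distX P k p.1 p.2 ≤ 1 then |g p.2 - g p.1| / distX P k p.1 p.2 ^ α else 0) (Finset.mem_univ p)
  change _ ≤ holN P k α f at hf
  change _ ≤ holN P k α g at hg
  dsimp only at hf hg ⊢
  split_ifs with h1
  · rw [if_pos h1] at hf hg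
    have hw : 0 ≤ distX P k p.1 p.2 ^ α := Real.rpow_nonneg (distX_nonneg P k _ _) α
    calc |f p.2 + g p.2 - (f p.1 + g p.1)| / distX P k p.1 p.2 ^ α
        ≤ (|f p.2 - f p.1| + |g p.2 - g p.1|) / distX P k p.1 p.2 ^ α := by
          apply div_le_div_of_nonneg_right _ hw
          calc |f p.2 + g p.2 - (f p.1 + g p.1)| = |(f p.2 - f p.1) + (g p.2 - g p.1)| := by ring_nf
            _ ≤ _ := abs_add_le _ _
      _ = |f p.2 - f p.1| / distX P k p.1 p.2 ^ α + |g p.2 - g p.1| / distX P k p.1 p.2 ^ α := add_div _ _ _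
      _ ≤ holN P k α f + holN P k α g := add_le_add hf hg
  · exact add_nonneg (holN_nonneg P k α f) (holN_nonneg P k α g)

/-- **Finite subadditivity**: ‖Σ_i f_i‖_α ≤ Σ_i ‖f_i‖_α. [cite: Balaban1984PropagatorsI, (1.109) p.35] -/
theorem holN_sum_le (k : ℕ) (α : ℝ) {ι : Type} (s : Finset ι) (f : ι → Site P 0 → ℝ) :
    holN P k α (fun x => ∑ i ∈ s, f i x) ≤ ∑ i ∈ s, holN P k α (f i) := by
  classical
  induction s using Finset.induction_on with
  | empty => simp only [Finset.sum_empty]; rw [holN_zero]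
  | @insert i s hi ih =>
    simp only [Finset.sum_insert hi]
    exact (holN_add_le k α (f i) (fun x => ∑ j ∈ s, f j x)).trans (add_le_add le_rfl ih)

/-- ε/(L^kε) = L^{−k} = η: the step of ∂^η. [folklore] -/
private theorem eps_div_spacing (k : ℕ) : P.eps / P.spacing k = ((P.L : ℝ) ^ k)⁻¹ := by
  have hε : P.eps ≠ 0 := P.eps_pos.ne'
  unfold Params.spacing
  field_simp

/-- The unit forward difference is η times ∂^η: u(x + ηe_μ) − u(x) = η·(∂^η_μu)(x). [cite: Balaban1984PropagatorsI, (1.31) p.23] -/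
theorem sub_eq_eta_mul_dEta (k : ℕ) (μ : Fin P.d) (u : Site P 0 → ℝ) (x : Site P 0) :
    u (Site.shift x μ) - u x = ((P.L : ℝ) ^ k)⁻¹ * (dEta P k μ *ᵥ u) x := by
  have hL : ((P.L : ℝ) ^ k) ≠ 0 := pow_ne_zero _ P.cast_L_pos.ne'
  rw [dEta, deriv_mulVec, eps_div_spacing, inv_inv, ← mul_assoc, inv_mul_cancel₀ hL, one_mul]

/-- **THE PRODUCT RULE WITH THE MEAN-VALUE STEP** (the located «lattice mean-value / product rule» behind the constant `Dh`
of `B5Transfer133.Display133.h1`): for supp ζ ⊂ Δ̃(y), α ≤ 1, and a function u with |u| ≤ M₀ and |∂^ηu| ≤ M₁ at the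
fine points within 3 of y (L^k-units), ‖ζu‖_α ≤ (‖ζ‖_α + |ζ|)·(M₀ + d·M₁).
[cite: Balaban1984PropagatorsI, (1.109), (1.111) p.35, (1.133) p.39] -/
theorem holN_cut_mul_le {k : ℕ} {α : ℝ} (hα : α ≤ 1) {y : Site P k} (ζ u : Site P 0 → ℝ)
    (hζ : ∀ x, ζ x ≠ 0 → inCube P k x y) {M₀ M₁ : ℝ} (hM₀ : 0 ≤ M₀) (hM₁ : 0 ≤ M₁)
    (h0 : ∀ w, T P 0 w (fine P k y) ≤ 3 * (P.L : ℝ) ^ k → |u w| ≤ M₀)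
    (h1 : ∀ w μ, T P 0 w (fine P k y) ≤ 3 * (P.L : ℝ) ^ k → |(dEta P k μ *ᵥ u) w| ≤ M₁) :
    holN P k α (fun x => ζ x * u x) ≤ cutHV P k α ζ * (M₀ + P.d * M₁) := by
  have hLk : (0 : ℝ) < (P.L : ℝ) ^ k := pow_pos P.cast_L_pos k
  have hB : 0 ≤ M₀ + P.d * M₁ := add_nonneg hM₀ (mul_nonneg (Nat.cast_nonneg _) hM₁)
  refine holN_le_of_pairs k α _ (mul_nonneg (cutHV_nonneg k α ζ) hB) fun x x' hne h1d => ?_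
  -- the trivial pairs
  by_cases hz : ζ x = 0 ∧ ζ x' = 0
  · rw [hz.1, hz.2, zero_mul, zero_mul, sub_self, abs_zero]
    exact mul_nonneg (mul_nonneg (cutHV_nonneg k α ζ) hB) (Real.rpow_nonneg (distX_nonneg P k x x') α)
  -- both points within 2 of y
  have hT : T P 0 x x' ≤ (P.L : ℝ) ^ k := by
    have h := h1d
    unfold distX at h
    rwa [inv_mul_le_iff₀ hLk, mul_one] at h
  have hx2 : T P 0 x (fine P k y) ≤ 2 * (P.L : ℝ) ^ k := by
    rcases not_and_or.mp hz with hx | hx'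
    · have := hζ x hx; unfold inCube at this; linarith
    · have h2 : T P 0 x' (fine P k y) ≤ (P.L : ℝ) ^ k := hζ x' hx'
      have := T_triangle P 0 x x' (fine P k y); linarith
  -- box points within 3 of y
  have hbox : ∀ w, InBox x x' w → T P 0 w (fine P k y) ≤ 3 * (P.L : ℝ) ^ k := by
    intro w hw
    have h3 := T_le_of_inBox hw
    have := T_triangle P 0 w x (fine P k y)
    rw [T_symm P 0 w x] at this
    linarith
  -- the mean value inequality
  have hstep : ∀ w, InBox x x' w → ∀ μ, |u (Site.shift w μ) - u w| ≤ ((P.L : ℝ) ^ k)⁻¹ * M₁ := by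
    intro w hw μ
    rw [sub_eq_eta_mul_dEta k μ u w, abs_mul, abs_of_pos (inv_pos.mpr hLk)]
    exact mul_le_mul_of_nonneg_left (h1 w μ (hbox w hw)) (inv_nonneg.mpr hLk.le)
  have hmv := abs_sub_le_T_mul u (mul_nonneg (inv_nonneg.mpr hLk.le) hM₁) hstep
  have hdist : P.d * T P 0 x x' * (((P.L : ℝ) ^ k)⁻¹ * M₁) = P.d * M₁ * distX P k x x' := by
    unfold distX; ring
  rw [hdist] at hmv
  -- distX ≤ distX^α (distX ∈ (0,1], α ≤ 1)
  have hpos : 0 < distX P k x x' := by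
    rcases eq_or_lt_of_le (distX_nonneg P k x x') with h0 | h0
    · exact absurd (eq_of_distX_eq_zero P h0.symm) hne
    · exact h0
  have hpow : distX P k x x' ≤ distX P k x x' ^ α := by
    have := Real.rpow_le_rpow_of_exponent_ge hpos h1d hα
    rwa [Real.rpow_one] at this
  have hdiff : |u x' - u x| ≤ (M₀ + P.d * M₁) * distX P k x x' ^ α := by
    calc |u x' - u x| ≤ P.d * M₁ * distX P k x x' := hmv
      _ ≤ P.d * M₁ * distX P k x x' ^ α := mul_le_mul_of_nonneg_left hpow (mul_nonneg (Nat.cast_nonneg _) hM₁)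
      _ ≤ (M₀ + P.d * M₁) * distX P k x x' ^ α :=
          mul_le_mul_of_nonneg_right (le_add_of_nonneg_left hM₀) (Real.rpow_nonneg (distX_nonneg P k x x') α)
  have hux : |u x| ≤ M₀ + P.d * M₁ :=
    (h0 x (by linarith)).trans (le_add_of_nonneg_right (mul_nonneg (Nat.cast_nonneg _) hM₁))
  have := holder_product_rule k α ζ u hne h1d hux hdiff
  simpa [mul_assoc] using this

/-! ## §3 The torus chart of T^{(j)}, cardinalities, ‖J‖ ≤ B|J| -/

variable (P) in
/-- **The tori T^{(j)} of `Setup` ARE charted tori** (`B5TorusCover.Chart` with e = the coordinates, ρ = the sup torus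
distance `T P j`, equality). [folklore] -/
def chartT (j : ℕ) : B5TorusCover.Chart (Site P j) (T P j) P.d where
  N := Nv P j
  hN := Nv_pos P j
  e := toT
  inj := toT_injective P j
  le := fun _ _ => le_rfl

/-- A fine point within 3L^k of the corner of y lies in a block B(w) with |y − w| ≤ 6 (indeed < 5). [cite: Balaban1984PropagatorsI, p.35 (the cubes)] -/
theorem proj_mem_nbrOf {k : ℕ} (hk : k ≤ P.m + P.K) {y : Site P k} {w : Site P 0}
    (hw : T P 0 w (fine P k y) ≤ 3 * (P.L : ℝ) ^ k) : Site.proj k k w ∈ B5TorusCover.nbrOf (T P k) 6 y := by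
  unfold B5TorusCover.nbrOf
  rw [Finset.mem_filter]
  refine ⟨Finset.mem_univ _, ?_⟩
  have hL : (0 : ℝ) < (P.L : ℝ) ^ k := pow_pos P.cast_L_pos k
  have h := T_proj_proj_lt hk (x := fine P k y) (z := w) (r := 3 * (P.L : ℝ) ^ k) (by rwa [T_symm])
  rw [proj_eq_blk k (fine P k y), B6Prop22OneScaleTorus.blk_fine P hk, mul_div_assoc, div_self hL.ne', mul_one] at h
  linarith

/-- **‖J‖ ≤ d·3^d·|J| for supp J ⊂ Δ̃(y′)** (|Δ̃(y′)| ≤ (2L^k + 1)^d ≤ 3^dL^{kd} fine points of η^d-measure each).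
[cite: Balaban1984PropagatorsI, (1.108) p.35, (1.114) p.36] -/
theorem l2NormV_le_supNormV {k : ℕ} (J : Fin P.d → Site P 0 → ℝ) (y' : Site P k)
    (hJ : ∀ ν x, J ν x ≠ 0 → inCube P k x y') : l2NormV P k J ≤ P.d * 3 ^ P.d * supNormV P J := by
  have hLk : (0 : ℝ) < (P.L : ℝ) ^ k := pow_pos P.cast_L_pos k
  set s := supNormV P J with hs
  have hs0 : 0 ≤ s := supNormV_nonneg J
  set C := Finset.univ.filter (fun x : Site P 0 => T P 0 (fine P k y') x ≤ (P.L : ℝ) ^ k) with hC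
  have hcard : (C.card : ℝ) ≤ (2 * ⌊(P.L : ℝ) ^ k⌋₊ + 1 : ℝ) ^ P.d :=
    B5TorusCover.ballCard_chart_le (chartT P 0) (fine P k y') hLk.le
  have hfloor : (2 * ⌊(P.L : ℝ) ^ k⌋₊ + 1 : ℝ) ≤ 3 * (P.L : ℝ) ^ k := by
    have h1 : (⌊(P.L : ℝ) ^ k⌋₊ : ℝ) ≤ (P.L : ℝ) ^ k := Nat.floor_le hLk.le
    have h2 : (1 : ℝ) ≤ (P.L : ℝ) ^ k := one_le_pow₀ (by exact_mod_cast P.L_pos)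
    linarith
  have hcard' : (C.card : ℝ) ≤ (3 : ℝ) ^ P.d * ((P.L : ℝ) ^ k) ^ P.d := by
    calc (C.card : ℝ) ≤ (2 * ⌊(P.L : ℝ) ^ k⌋₊ + 1 : ℝ) ^ P.d := hcard
      _ ≤ (3 * (P.L : ℝ) ^ k) ^ P.d := pow_le_pow_left₀ (by positivity) hfloor _
      _ = _ := mul_pow _ _ _
  -- each component: Σ_x J_ν² ≤ |C|·s²
  have hcomp : ∀ ν, ∑ x, (((P.L : ℝ) ^ k)⁻¹) ^ P.d * J ν x ^ 2 ≤ (3 : ℝ) ^ P.d * s ^ 2 := by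
    intro ν
    have hsub : ∑ x, (((P.L : ℝ) ^ k)⁻¹) ^ P.d * J ν x ^ 2 = ∑ x ∈ C, (((P.L : ℝ) ^ k)⁻¹) ^ P.d * J ν x ^ 2 := by
      symm
      refine Finset.sum_subset (Finset.subset_univ _) fun x _ hx => ?_
      have hJ0 : J ν x = 0 := by
        by_contra hne
        apply hx
        rw [hC, Finset.mem_filter]
        exact ⟨Finset.mem_univ _, by rw [T_symm]; exact hJ ν x hne⟩
      rw [hJ0]; ring
    have hterm : ∀ x ∈ C, (((P.L : ℝ) ^ k)⁻¹) ^ P.d * J ν x ^ 2 ≤ (((P.L : ℝ) ^ k)⁻¹) ^ P.d * s ^ 2 := by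
      intro x _
      refine mul_le_mul_of_nonneg_left ?_ (by positivity)
      have h := (le_supN P (J ν) x).trans (supN_le_supNormV J ν)
      rw [← sq_abs]
      exact pow_le_pow_left₀ (abs_nonneg _) h 2
    rw [hsub]
    calc ∑ x ∈ C, (((P.L : ℝ) ^ k)⁻¹) ^ P.d * J ν x ^ 2 ≤ ∑ x ∈ C, (((P.L : ℝ) ^ k)⁻¹) ^ P.d * s ^ 2 :=
          Finset.sum_le_sum hterm
      _ = C.card * ((((P.L : ℝ) ^ k)⁻¹) ^ P.d * s ^ 2) := by rw [Finset.sum_const, nsmul_eq_mul]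
      _ ≤ (3 : ℝ) ^ P.d * ((P.L : ℝ) ^ k) ^ P.d * ((((P.L : ℝ) ^ k)⁻¹) ^ P.d * s ^ 2) :=
          mul_le_mul_of_nonneg_right hcard' (by positivity)
      _ = (3 : ℝ) ^ P.d * s ^ 2 := by rw [inv_pow]; field_simp
  have hsq : l2NormV P k J ^ 2 ≤ (P.d * 3 ^ P.d * s) ^ 2 := by
    rw [l2NormV, Real.sq_sqrt (Finset.sum_nonneg fun ν _ => Finset.sum_nonneg fun x _ => by positivity)]
    calc ∑ ν, ∑ x, (((P.L : ℝ) ^ k)⁻¹) ^ P.d * J ν x ^ 2 ≤ ∑ _ν : Fin P.d, (3 : ℝ) ^ P.d * s ^ 2 :=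
          Finset.sum_le_sum fun ν _ => hcomp ν
      _ = P.d * ((3 : ℝ) ^ P.d * s ^ 2) := by rw [Finset.sum_const, Finset.card_univ, Fintype.card_fin, nsmul_eq_mul]
      _ ≤ (P.d * 3 ^ P.d * s) ^ 2 := by
          have hd1 : (1 : ℝ) ≤ P.d := by exact_mod_cast P.hd
          have h3 : (1 : ℝ) ≤ (3 : ℝ) ^ P.d := one_le_pow₀ (by norm_num)
          have ht : (1 : ℝ) ≤ P.d * 3 ^ P.d := one_le_mul_of_one_le_of_one_le hd1 h3
          have hss : 0 ≤ s ^ 2 := sq_nonneg s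
          calc (P.d : ℝ) * ((3 : ℝ) ^ P.d * s ^ 2) = (P.d * 3 ^ P.d) * s ^ 2 := by ring
            _ ≤ (P.d * 3 ^ P.d) ^ 2 * s ^ 2 := by
                refine mul_le_mul_of_nonneg_right ?_ hss
                nlinarith [ht]
            _ = (P.d * 3 ^ P.d * s) ^ 2 := by ring
  have hl0 : 0 ≤ l2NormV P k J := Real.sqrt_nonneg _
  have hr0 : 0 ≤ (P.d : ℝ) * 3 ^ P.d * s := by positivity
  exact (pow_le_pow_iff_left₀ hl0 hr0 two_ne_zero).mp hsq

/-! ## §4 The carrier between the G′-setting and the G₀-setting, its facts, the row sums -/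

variable (P) in
/-- **(G₀∇*J) as a function**: x ↦ Σ_ν (G₀^{(μ)}∂*_νJ_ν)(x). [cite: Balaban1984PropagatorsI, (1.110) p.35] -/
def divF (k : ℕ) (G : Matrix (Site P 0) (Site P 0) ℝ) (J : Fin P.d → Site P 0 → ℝ) : Site P 0 → ℝ :=
  fun x => opDiv P k G J x

/-- `divF` is the sum of the functions (G∂*_ν)J_ν. [cite: Balaban1984PropagatorsI, (1.110) p.35] -/
theorem divF_eq_sum (k : ℕ) (G : Matrix (Site P 0) (Site P 0) ℝ) (J : Fin P.d → Site P 0 → ℝ) :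
    divF P k G J = ∑ ν, (G * (dEta P k ν)ᵀ) *ᵥ J ν := by
  funext x
  rw [Finset.sum_apply]
  rfl

variable (P) in
/-- **The cube pieces of the carrier**: p = 0 ↦ (1_{B(y″)}V(G₀J)_ν)_ν, p = 2 ↦ 1_{B(y″)}V(G₀∇*J) in every component, the other
four members ↦ 0 (not used by the transfer, `pIdx = ![0,0,2,0]`). [cite: Balaban1984PropagatorsI, (1.133) p.39] -/
def pieceV (a msq : ℝ) (k : ℕ) (μ : Fin P.d) (p : Fin 6) (J : Fin P.d → Site P 0 → ℝ) (y'' : Site P k) :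
    Fin P.d → Site P 0 → ℝ :=
  if p = 0 then fun ν => pieceFn P k (V P a k μ) (G0 P a msq k μ *ᵥ J ν) y''
  else if p = 2 then fun _ => pieceFn P k (V P a k μ) (divF P k (G0 P a msq k μ) J) y''
  else fun _ _ => 0

/-- unfolding at p = 0. [cite: Balaban1984PropagatorsI, (1.133) p.39] -/
theorem pieceV_zero (a msq : ℝ) (k : ℕ) (μ : Fin P.d) (J : Fin P.d → Site P 0 → ℝ) (y'' : Site P k) :
    pieceV P a msq k μ 0 J y'' = fun ν => pieceFn P k (V P a k μ) (G0 P a msq k μ *ᵥ J ν) y'' := by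
  simp [pieceV]

/-- unfolding at p = 2. [cite: Balaban1984PropagatorsI, (1.133) p.39] -/
theorem pieceV_two (a msq : ℝ) (k : ℕ) (μ : Fin P.d) (J : Fin P.d → Site P 0 → ℝ) (y'' : Site P k) :
    pieceV P a msq k μ 2 J y'' = fun _ => pieceFn P k (V P a k μ) (divF P k (G0 P a msq k μ) J) y'' := by
  simp [pieceV]

/-- The sites of the G₀-setting form a finite type (they are `Site P k`). [folklore] -/
instance instFintypeG0Site (a msq : ℝ) (k : ℕ) (μ : Fin P.d) : Fintype (g0Setting P a msq k μ).Site :=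
  inferInstanceAs (Fintype (Site P k))

/-- Decidable equality of the sites of the G₀-setting. [folklore] -/
instance instDecEqG0Site (a msq : ℝ) (k : ℕ) (μ : Fin P.d) : DecidableEq (g0Setting P a msq k μ).Site :=
  inferInstanceAs (DecidableEq (Site P k))

variable (P) in
/-- **THE CARRIER OF THE (1.133)-TRANSFER ON THE TORUS** (`B5Transfer133.Carrier133` between `gpSetting P a m² k o` and
`g0Setting P a m² k μ`): σ = ι = κ = id (ONE carrier), T₁ = the whole unit lattice T₁^{(k)}, nbr y = {w : |y − w| ≤ 6},
ζ_w = 1_{Δ̃(w)}, pieces `pieceV`. [cite: Balaban1984PropagatorsI, (1.132)–(1.133) p.39] -/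
def carrier (a msq : ℝ) (k : ℕ) (μ : Fin P.d) (o : L2Half P) :
    B5Transfer133.Carrier133 (gpSetting P a msq k o) (g0Setting P a msq k μ) where
  σ := fun y => y
  ι := fun J => J
  κ := fun ζ => ζ
  T1 := (Finset.univ : Finset (Site P k))
  nbr := fun y : Site P k => (B5TorusCover.nbrOf (T P k) 6 y : Finset (Site P k))
  ζ0 := fun w : Site P k => cubeInd P k w
  piece := pieceV P a msq k μ

section Facts

variable {a msq : ℝ} (ha : 0 < a) (hm : 0 ≤ msq) {k : ℕ} (hk1 : 1 ≤ k) (hk : k ≤ P.m + P.K) (μ : Fin P.d)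
  (o : L2Half P)

/-- The sup norm of a scalar function bounded pointwise. [folklore] -/
private theorem supN_le {f : Site P 0 → ℝ} {b : ℝ} (h : ∀ x, |f x| ≤ b) : supN P f ≤ b :=
  Finset.sup'_le _ _ fun x _ => h x

/-- The sup norm of a vector function bounded componentwise-pointwise. [folklore] -/
private theorem supNormV_le {J : Fin P.d → Site P 0 → ℝ} {b : ℝ} (h : ∀ ν x, |J ν x| ≤ b) : supNormV P J ≤ b :=
  Finset.sup'_le _ _ fun ν _ => supN_le (h ν)

/-- The radius-`<6` neighbourhood sits inside the radius-`≤6` one; sums of non-negative terms compare. [folklore] -/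
private theorem sum_nbhd_le_sum_nbrOf (y : Site P k) {g : Site P k → ℝ} (hg : ∀ w, 0 ≤ g w) :
    ∑ w ∈ nbhd P k y 6, g w ≤ ∑ w ∈ B5TorusCover.nbrOf (T P k) 6 y, g w := by
  refine Finset.sum_le_sum_of_subset_of_nonneg ?_ fun w _ _ => hg w
  intro w hw
  unfold B5TorusCover.nbrOf
  rw [Finset.mem_filter]
  exact ⟨Finset.mem_univ _, (mem_nbhd.mp hw).le⟩

include ha hk1 hk in
/-- **`piece_norm` for p = 0**: |1_{B(y″)}V(G₀J)_ν| ≤ 2a·Σ_{|w−y″|≤6} ‖ζ_wG₀J‖. [cite: Balaban1984PropagatorsI, (1.133) p.39] -/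
theorem pieceV_norm_zero (J : Fin P.d → Site P 0 → ℝ) (y'' : Site P k) :
    supNormV P (pieceV P a msq k μ 0 J y'') ≤
      2 * a * ∑ w ∈ B5TorusCover.nbrOf (T P k) 6 y'', opL2loc P k (G0 P a msq k μ) 0 J (cubeInd P k w) := by
  rw [pieceV_zero]
  refine supNormV_le fun ν x => ?_
  calc |pieceFn P k (V P a k μ) (G0 P a msq k μ *ᵥ J ν) y'' x|
      ≤ 2 * a * ∑ w ∈ nbhd P k y'' 6, nz P k w (G0 P a msq k μ *ᵥ J ν) := abs_pieceFn_le ha hk1 hk μ _ y'' x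
    _ ≤ 2 * a * ∑ w ∈ B5TorusCover.nbrOf (T P k) 6 y'', nz P k w (G0 P a msq k μ *ᵥ J ν) :=
        mul_le_mul_of_nonneg_left (sum_nbhd_le_sum_nbrOf y'' fun w => nz_nonneg k w _) (by positivity)
    _ ≤ 2 * a * ∑ w ∈ B5TorusCover.nbrOf (T P k) 6 y'', opL2loc P k (G0 P a msq k μ) 0 J (cubeInd P k w) := by
        refine mul_le_mul_of_nonneg_left (Finset.sum_le_sum fun w _ => ?_) (by positivity)
        exact l2S_le_l2Fam k (fun ν' x => cubeInd P k w x * (G0 P a msq k μ *ᵥ J ν') x) ν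

include ha hk1 hk in
/-- **`piece_norm` for p = 2**: |1_{B(y″)}V(G₀∇*J)| ≤ 2a·Σ_{|w−y″|≤6} ‖ζ_wG₀∇*J‖. [cite: Balaban1984PropagatorsI, (1.133) p.39] -/
theorem pieceV_norm_two (J : Fin P.d → Site P 0 → ℝ) (y'' : Site P k) :
    supNormV P (pieceV P a msq k μ 2 J y'') ≤
      2 * a * ∑ w ∈ B5TorusCover.nbrOf (T P k) 6 y'', opL2loc P k (G0 P a msq k μ) 2 J (cubeInd P k w) := by
  rw [pieceV_two]
  refine supNormV_le fun _ x => ?_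
  calc |pieceFn P k (V P a k μ) (divF P k (G0 P a msq k μ) J) y'' x|
      ≤ 2 * a * ∑ w ∈ nbhd P k y'' 6, nz P k w (divF P k (G0 P a msq k μ) J) := abs_pieceFn_le ha hk1 hk μ _ y'' x
    _ ≤ 2 * a * ∑ w ∈ B5TorusCover.nbrOf (T P k) 6 y'', nz P k w (divF P k (G0 P a msq k μ) J) :=
        mul_le_mul_of_nonneg_left (sum_nbhd_le_sum_nbrOf y'' fun w => nz_nonneg k w _) (by positivity)
    _ ≤ 2 * a * ∑ w ∈ B5TorusCover.nbrOf (T P k) 6 y'', opL2loc P k (G0 P a msq k μ) 2 J (cubeInd P k w) := by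
        refine mul_le_mul_of_nonneg_left (Finset.sum_le_sum fun w _ => ?_) (by positivity)
        exact l2S_le_l2Fam k (fun (_ : Unit) x => cubeInd P k w x * divF P k (G0 P a msq k μ) J x) ()

include ha hk1 hk in
/-- **`piece_norm` for every member** (p ∉ {0, 2}: the zero source). [cite: Balaban1984PropagatorsI, (1.133) p.39] -/
theorem pieceV_norm (p : Fin 6) (J : Fin P.d → Site P 0 → ℝ) (y'' : Site P k) :
    supNormV P (pieceV P a msq k μ p J y'') ≤
      2 * a * ∑ w ∈ B5TorusCover.nbrOf (T P k) 6 y'', opL2loc P k (G0 P a msq k μ) p J (cubeInd P k w) := by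
  by_cases h0 : p = 0
  · subst h0; exact pieceV_norm_zero ha hk1 hk μ J y''
  by_cases h2 : p = 2
  · subst h2; exact pieceV_norm_two ha hk1 hk μ J y''
  have hz : pieceV P a msq k μ p J y'' = fun _ _ => 0 := by simp [pieceV, h0, h2]
  rw [hz]
  have hs : supNormV P (fun (_ : Fin P.d) (_ : Site P 0) => (0 : ℝ)) = 0 :=
    le_antisymm (supNormV_le fun _ _ => by simp) (supNormV_nonneg _)
  rw [hs]
  exact mul_nonneg (by positivity) (Finset.sum_nonneg fun w _ => opL2loc_nonneg _ p J _)

include ha hk1 hk in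
/-- **THE CARRIER FACTS** (`B5Transfer133.CarrierFacts`) for the torus carrier, with A = 2a, any B ≥ d·3^d, r0 = 6, any
Nn ≥ 13^d: identities for the maps, the triangle inequality of T₁^{(k)}, neighbourhood sizes (`B5TorusCover`), the cut-offs
ζ_w = 1_{Δ̃(w)}, the supports and THE SUP BOUNDS OF THE PIECES (`B5Pieces133Torus`), ‖J‖ ≤ B|J|.
[cite: Balaban1984PropagatorsI, (1.133) p.39, (1.108)–(1.109) p.35] -/
theorem carrierFacts {B Nn : ℝ} (hB : (P.d : ℝ) * 3 ^ P.d ≤ B) (hNn : (13 : ℝ) ^ P.d ≤ Nn) :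
    B5Transfer133.CarrierFacts (carrier P a msq k μ o) (2 * a) B 6 Nn where
  dist_le := fun _ _ => le_rfl
  tri := fun y y'' y' => T_triangle P k y y'' y'
  supp_map := fun _ _ h => h
  cut_map := fun _ _ h => h
  supNorm_map := fun _ => le_rfl
  holder_map := fun _ _ => le_rfl
  cutH_map := fun _ _ => le_rfl
  nbr_dist := fun y w hw => by
    show T P k y w ≤ 6
    exact B5TorusCover.nbrOf_dist (ρ := T P k) 6 y w hw
  nbr_card := fun y => by
    show ((B5TorusCover.nbrOf (T P k) 6 y).card : ℝ) ≤ Nn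
    have h := B5TorusCover.nbrOf_card (chartT P k) (by norm_num : (0 : ℝ) ≤ 6) y
    have h13 : (2 * ⌊(6 : ℝ)⌋₊ + 1 : ℝ) = 13 := by norm_num
    rw [h13] at h
    exact h.trans hNn
  r0_nonneg := by norm_num
  Nn_nonneg := (pow_nonneg (by norm_num) _).trans hNn
  ζ0_in := fun _ _ h => cubeInd_ne_zero h
  ζ0_sup := fun w => supN_cubeInd_le k w
  piece_supp := by
    intro p J y'' _ ν x hx
    change pieceV P a msq k μ p J y'' ν x ≠ 0 at hx
    unfold pieceV at hx
    split_ifs at hx with h0 h2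
    · exact inCube_of_proj_eq hk (proj_eq_of_pieceFn_ne_zero hx)
    · exact inCube_of_proj_eq hk (proj_eq_of_pieceFn_ne_zero hx)
    · exact absurd rfl hx
  piece_norm := fun p J y'' _ => pieceV_norm ha hk1 hk μ p J y''
  A_nonneg := by positivity
  l2_le_sup := fun J y' hJ => (l2NormV_le_supNormV J y' hJ).trans
    (mul_le_mul_of_nonneg_right hB (supNormV_nonneg J))
  B_nonneg := le_trans (by positivity) hB

/-- **THE ROW SUMS `URow`** of the unit lattice T₁^{(k)}: Σ_{y″} e^{−κ|y−y″|} ≤ K_d(κ) uniformly (`B5TorusCover.uRow_of_chart`).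
[cite: Balaban1984PropagatorsI, (1.133) p.39] -/
theorem uRow {κ : ℝ} (hκ : 0 < κ) :
    B5Transfer133.URow (carrier P a msq k μ o) κ (B4Sect5Proof.latticeConst P.d κ) :=
  B5TorusCover.uRow_of_chart (carrier P a msq k μ o) (chartT P k) hκ

end Facts

/-! ## §5 The display (1.133) entrywise: `Display133` for the torus carrier -/

section Display

variable {a msq : ℝ} (ha : 0 < a) (hm : 0 ≤ msq) {k : ℕ} (hk1 : 1 ≤ k) (hk : k ≤ P.m + P.K) (μ : Fin P.d)
  (o : L2Half P)

include ha hm hk1 in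
/-- The G′-kernel `ED` is `∂^η_λG′` in the operator vocabulary (k ≥ 1). [cite: Balaban1984PropagatorsI, (1.110) p.35] -/
theorem ED_eq' (lam : Fin P.d) (f : Site P 0 → ℝ) (x : Site P 0) :
    ED P a msq k lam f x = ((dEta P k lam * Grs P a msq k) *ᵥ f) x := by
  have hs : P.spacing k ≠ 0 := (P.spacing_pos k).ne'
  rw [ED, G_eq_smul_Grs (P := P) ha hm hk1, dEta, deriv_rescale]
  simp only [Matrix.smul_mul, Matrix.mul_smul, Matrix.smul_mulVec, Pi.smul_apply, smul_eq_mul]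
  field_simp

include ha hm hk1 in
/-- The G′-kernel `E` of (1.136) is `∂_λG′∂*_ν` in the operator vocabulary (k ≥ 1). [cite: Balaban1984PropagatorsI, (1.136) p.39] -/
theorem E_eq' (lam ν : Fin P.d) (f : Site P 0 → ℝ) (x : Site P 0) :
    B5Display136Torus.E P a msq k lam ν f x = ((dEta P k lam * Grs P a msq k * (dEta P k ν)ᵀ) *ᵥ f) x := by
  rw [B5Display136Torus.E, G_eq_smul_Grs (P := P) ha hm hk1]
  simp only [dEta, deriv_rescale, Matrix.smul_mul, Matrix.mul_smul, Matrix.transpose_smul, Matrix.smul_mulVec,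
    Pi.smul_apply, smul_eq_mul]
  ring

/-- The pieces are linear in the decomposed function: 1_B·V(Σ_ν F_ν) = Σ_ν 1_B·VF_ν. [cite: Balaban1984PropagatorsI, (1.133) p.39] -/
theorem pieceFn_sum (V' : Matrix (Site P 0) (Site P 0) ℝ) (F : Fin P.d → Site P 0 → ℝ) (y'' : Site P k) (x : Site P 0) :
    pieceFn P k V' (∑ ν, F ν) y'' x = ∑ ν, pieceFn P k V' (F ν) y'' x := by
  simp only [pieceFn, Matrix.mulVec_sum, Finset.sum_apply, Finset.mul_sum]

include ha hm hk1 hk in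
/-- **(G₀J)_ν pointwise**: (G₀^{(μ)}J_ν)(x) = (G′J_ν)(x) + Σ_{y″}(G′·piece₀(y″)_ν)(x). [cite: Balaban1984PropagatorsI, (1.133) p.39] -/
theorem opK0_G0_eq (J : Fin P.d → Site P 0 → ℝ) (ν : Fin P.d) (x : Site P 0) :
    opK0 P (G0 P a msq k μ) (J ν) x =
      E0 P a msq k (J ν) x + ∑ y'' : Site P k, E0 P a msq k (pieceV P a msq k μ 0 J y'' ν) x := by
  rw [opK0, G0_apply_pieces ha hm hk1 hk μ, B5Display135Torus.E0_eq ha hm hk1]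
  congr 1
  refine Finset.sum_congr rfl fun y'' _ => ?_
  rw [B5Display135Torus.E0_eq ha hm hk1, pieceV_zero]

include ha hm hk1 hk in
/-- **(∇G₀J)_{λν} pointwise**. [cite: Balaban1984PropagatorsI, (1.133) p.39] -/
theorem opKD_G0_eq (J : Fin P.d → Site P 0 → ℝ) (lam ν : Fin P.d) (x : Site P 0) :
    opKD P k (G0 P a msq k μ) lam (J ν) x =
      ED P a msq k lam (J ν) x + ∑ y'' : Site P k, ED P a msq k lam (pieceV P a msq k μ 0 J y'' ν) x := by
  rw [opKD, DG0_apply_pieces ha hm hk1 hk μ, ED_eq' ha hm hk1]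
  congr 1
  refine Finset.sum_congr rfl fun y'' _ => ?_
  rw [ED_eq' ha hm hk1, pieceV_zero]

include ha hm hk1 hk in
/-- **(ΔG₀J)_ν pointwise**. [cite: Balaban1984PropagatorsI, (1.133) p.39] -/
theorem opKL_G0_eq (J : Fin P.d → Site P 0 → ℝ) (ν : Fin P.d) (x : Site P 0) :
    opKL P k (G0 P a msq k μ) (J ν) x =
      EL P a msq k (J ν) x + ∑ y'' : Site P k, EL P a msq k (pieceV P a msq k μ 0 J y'' ν) x := by
  rw [opKL, lapEta, DG0_apply_pieces ha hm hk1 hk μ]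
  simp only [EL, pieceV_zero]

include ha hm hk1 hk in
/-- **(G₀∇*J) pointwise**: (G₀∇*J)(x) = (G′∇*J)(x) + Σ_{y″}(G′·piece₂(y″))(x). [cite: Balaban1984PropagatorsI, (1.133) p.39] -/
theorem opDiv_G0_eq (J : Fin P.d → Site P 0 → ℝ) (x : Site P 0) :
    opDiv P k (G0 P a msq k μ) J x =
      gDiv P a msq k J x + ∑ y'' : Site P k, E0 P a msq k (pieceV P a msq k μ 2 J y'' (dir0 P)) x := by
  unfold opDiv gDiv
  simp only [opK1, G0E_apply_pieces ha hm hk1 hk μ, Finset.sum_add_distrib]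
  congr 1
  · refine Finset.sum_congr rfl fun ν _ => ?_
    rw [B5Display135Torus.E1_eq ha hm hk1, dEta]
  · rw [Finset.sum_comm]
    refine Finset.sum_congr rfl fun y'' _ => ?_
    rw [pieceV_two, B5Display135Torus.E0_eq ha hm hk1, divF_eq_sum]
    simp only [← Finset.sum_apply (a := x), ← Matrix.mulVec_sum]
    congr 1
    funext z
    rw [Finset.sum_apply, pieceFn_sum]

include ha hm hk1 hk in
/-- **(∇G₀∇*J)_λ pointwise**. [cite: Balaban1984PropagatorsI, (1.133) p.39] -/
theorem opDD_G0_eq (J : Fin P.d → Site P 0 → ℝ) (lam : Fin P.d) (x : Site P 0) :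
    opDD P k (G0 P a msq k μ) J lam x =
      gDD P a msq k J lam x + ∑ y'' : Site P k, ED P a msq k lam (pieceV P a msq k μ 2 J y'' (dir0 P)) x := by
  unfold opDD gDD
  simp only [opKDD, DG0E_apply_pieces ha hm hk1 hk μ, Finset.sum_add_distrib]
  congr 1
  · refine Finset.sum_congr rfl fun ν _ => ?_
    rw [E_eq' ha hm hk1]
  · rw [Finset.sum_comm]
    refine Finset.sum_congr rfl fun y'' _ => ?_
    rw [pieceV_two, ED_eq' ha hm hk1, divF_eq_sum]
    simp only [← Finset.sum_apply (a := x), ← Matrix.mulVec_sum]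
    congr 1
    funext z
    rw [Finset.sum_apply, pieceFn_sum]

/-- The cube sup entry n = 0 of the G′-setting is non-negative. [cite: Balaban1984PropagatorsI, (1.110) p.35] -/
private theorem e0_nonneg' (J : Fin P.d → Site P 0 → ℝ) (y : Site P k) : 0 ≤ (gpSetting P a msq k o).e 0 J y := by
  rw [gpSetting_e_zero]; exact cubeSup_nonneg y _ _

/-- The cube sup entry n = 1 of the G′-setting is non-negative. [cite: Balaban1984PropagatorsI, (1.110) p.35] -/
private theorem e1_nonneg' (J : Fin P.d → Site P 0 → ℝ) (y : Site P k) : 0 ≤ (gpSetting P a msq k o).e 1 J y := by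
  rw [gpSetting_e_one]; exact cubeSup_nonneg y _ _

/-- `h1 ≥ 0` in the G′-setting. [cite: Balaban1984PropagatorsI, (1.111) p.35] -/
private theorem h1_nonneg' (J : Fin P.d → Site P 0 → ℝ) (α : ℝ) (ζ : Site P 0 → ℝ) :
    0 ≤ (gpSetting P a msq k o).h1 J α ζ :=
  (holN_nonneg P k α _).trans (le_max_right _ _)

include ha hm hk1 hk in
/-- **THE DISPLAY (1.133) ENTRYWISE** (`B5Transfer133.Display133`) for the torus carrier, Dh ≥ d + 1: every sup / Hölder entry
of Prop. 1.2 for G₀^{(μ)} at (J, y) is ≤ the same entry for G′ plus the sum over y″ ∈ T₁ of first-order entries of G′ on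
the pieces — from (1.133) with the cube decomposition (`B5Pieces133Torus.DG0E_apply_pieces`), subadditivity of the cube
sups and Hölder norms, and, for ‖ζG₀∇*J‖_α, the product rule with the lattice mean-value step (`holN_cut_mul_le`).
[cite: Balaban1984PropagatorsI, (1.133) p.39, (1.110)–(1.113) pp.35–36] -/
theorem display133 {Dh : ℝ} (hDh : (P.d : ℝ) + 1 ≤ Dh) :
    B5Transfer133.Display133 (carrier P a msq k μ o) Dh where
  Dh_nonneg := le_trans (by positivity) hDh
  sup := by
    intro n J y
    fin_cases n
    · show opEntry P k (G0 P a msq k μ) 0 J y ≤ (gpSetting P a msq k o).e 0 J y +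
        ∑ y'' : Site P k, (gpSetting P a msq k o).e 0 (pieceV P a msq k μ 0 J y'') y
      refine opEntry_zero_le _ J y fun ν x hx => ?_
      rw [opK0_G0_eq ha hm hk1 hk μ]
      refine (abs_add_le _ _).trans (add_le_add ?_ ((Finset.abs_sum_le_sum_abs _ _).trans (Finset.sum_le_sum
        fun y'' _ => ?_)))
      · exact le_cubeSup (dir0 P) (fun ν => E0 P a msq k (J ν)) ν hx
      · exact le_cubeSup (dir0 P) (fun ν => E0 P a msq k (pieceV P a msq k μ 0 J y'' ν)) ν hx
    · show opEntry P k (G0 P a msq k μ) 1 J y ≤ (gpSetting P a msq k o).e 1 J y +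
        ∑ y'' : Site P k, (gpSetting P a msq k o).e 1 (pieceV P a msq k μ 0 J y'') y
      refine opEntry_one_le _ J y fun lam ν x hx => ?_
      rw [opKD_G0_eq ha hm hk1 hk μ]
      refine (abs_add_le _ _).trans (add_le_add ?_ ((Finset.abs_sum_le_sum_abs _ _).trans (Finset.sum_le_sum
        fun y'' _ => ?_)))
      · exact le_cubeSup (dir0 P, dir0 P) (fun p : Fin P.d × Fin P.d => ED P a msq k p.1 (J p.2)) (lam, ν) hx
      · exact le_cubeSup (dir0 P, dir0 P)
          (fun p : Fin P.d × Fin P.d => ED P a msq k p.1 (pieceV P a msq k μ 0 J y'' p.2)) (lam, ν) hx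
    · show opEntry P k (G0 P a msq k μ) 2 J y ≤ (gpSetting P a msq k o).e 2 J y +
        ∑ y'' : Site P k, (gpSetting P a msq k o).e 0 (pieceV P a msq k μ 2 J y'') y
      refine opEntry_two_le _ J y fun x hx => ?_
      rw [opDiv_G0_eq ha hm hk1 hk μ]
      refine (abs_add_le _ _).trans (add_le_add ?_ ((Finset.abs_sum_le_sum_abs _ _).trans (Finset.sum_le_sum
        fun y'' _ => ?_)))
      · exact le_cubeSup () (fun _ : Unit => gDiv P a msq k J) () hx
      · exact le_cubeSup (dir0 P) (fun ν => E0 P a msq k (pieceV P a msq k μ 2 J y'' ν)) (dir0 P) hx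
    · show opEntry P k (G0 P a msq k μ) 3 J y ≤ (gpSetting P a msq k o).e 3 J y +
        ∑ y'' : Site P k, (gpSetting P a msq k o).e 3 (pieceV P a msq k μ 0 J y'') y
      refine opEntry_three_le _ J y fun ν x hx => ?_
      rw [opKL_G0_eq ha hm hk1 hk μ]
      refine (abs_add_le _ _).trans (add_le_add ?_ ((Finset.abs_sum_le_sum_abs _ _).trans (Finset.sum_le_sum
        fun y'' _ => ?_)))
      · exact le_cubeSup (dir0 P) (fun ν => EL P a msq k (J ν)) ν hx
      · exact le_cubeSup (dir0 P) (fun ν => EL P a msq k (pieceV P a msq k μ 0 J y'' ν)) ν hx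
  e4 := by
    intro J y
    show opE4 P k (G0 P a msq k μ) J y ≤ e4V P a msq k J y +
      ∑ y'' : Site P k, (gpSetting P a msq k o).e 1 (pieceV P a msq k μ 2 J y'') y
    refine opE4_le _ J y fun lam x hx => ?_
    rw [opDD_G0_eq ha hm hk1 hk μ]
    refine (abs_add_le _ _).trans (add_le_add ?_ ((Finset.abs_sum_le_sum_abs _ _).trans (Finset.sum_le_sum
      fun y'' _ => ?_)))
    · exact le_cubeSup (dir0 P) (gDD P a msq k J) lam hx
    · exact le_cubeSup (dir0 P, dir0 P)
        (fun p : Fin P.d × Fin P.d => ED P a msq k p.1 (pieceV P a msq k μ 2 J y'' p.2)) (lam, dir0 P) hx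
  h2 := by
    intro J α ζ y _
    show opH2 P k (G0 P a msq k μ) J α ζ ≤ h2V P a msq k J α ζ +
      ∑ y'' : Site P k, (gpSetting P a msq k o).h1 (pieceV P a msq k μ 2 J y'') α ζ
    refine opH2_le _ J α ζ fun lam => ?_
    have hfun : (fun x => ζ x * opDD P k (G0 P a msq k μ) J lam x) = fun x =>
        ζ x * gDD P a msq k J lam x + ∑ y'' : Site P k, ζ x * ED P a msq k lam (pieceV P a msq k μ 2 J y'' (dir0 P)) x := by
      funext x; rw [opDD_G0_eq ha hm hk1 hk μ, mul_add, Finset.mul_sum]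
    rw [hfun]
    refine (holN_add_le k α _ _).trans (add_le_add ?_ ((holN_sum_le k α _ _).trans (Finset.sum_le_sum fun y'' _ => ?_)))
    · exact Finset.le_sup' (fun μ' => holN P k α (fun x => ζ x * gDD P a msq k J μ' x)) (Finset.mem_univ lam)
    · refine le_trans ?_ (le_max_left _ _)
      exact Finset.le_sup' (fun p : Fin P.d × Fin P.d =>
        holN P k α (fun x => ζ x * ED P a msq k p.1 (pieceV P a msq k μ 2 J y'' p.2) x)) (Finset.mem_univ (lam, dir0 P))
  h1 := by
    intro J α ζ y hζ
    change ∀ x, ζ x ≠ 0 → inCube P k x y at hζ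
    -- the right-hand side and its non-negativity
    set R := (gpSetting P a msq k o).h1 J α ζ + ∑ y'' : Site P k, ((gpSetting P a msq k o).h1 (pieceV P a msq k μ 0 J y'') α ζ +
      Dh * cutHV P k α ζ * ∑ w ∈ B5TorusCover.nbrOf (T P k) 6 y,
        ((gpSetting P a msq k o).e 0 (pieceV P a msq k μ 2 J y'') w + (gpSetting P a msq k o).e 1 (pieceV P a msq k μ 2 J y'') w))
      with hR
    show (g0Setting P a msq k μ).h1 J α ζ ≤ R
    have hDh0 : 0 ≤ Dh := le_trans (by positivity) hDh
    have hsumw : ∀ y'' : Site P k, 0 ≤ ∑ w ∈ B5TorusCover.nbrOf (T P k) 6 y,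
        ((gpSetting P a msq k o).e 0 (pieceV P a msq k μ 2 J y'') w + (gpSetting P a msq k o).e 1 (pieceV P a msq k μ 2 J y'') w) :=
      fun y'' => Finset.sum_nonneg fun w _ => add_nonneg (e0_nonneg' o _ w) (e1_nonneg' o _ w)
    have hDterm : ∀ y'' : Site P k, 0 ≤ Dh * cutHV P k α ζ * ∑ w ∈ B5TorusCover.nbrOf (T P k) 6 y,
        ((gpSetting P a msq k o).e 0 (pieceV P a msq k μ 2 J y'') w + (gpSetting P a msq k o).e 1 (pieceV P a msq k μ 2 J y'') w) :=
      fun y'' => mul_nonneg (mul_nonneg hDh0 (cutHV_nonneg k α ζ)) (hsumw y'')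
    have hR0 : 0 ≤ R := add_nonneg (h1_nonneg' o J α ζ)
      (Finset.sum_nonneg fun y'' _ => add_nonneg (h1_nonneg' o _ α ζ) (hDterm y''))
    show (if α ≤ 1 then max (opHD P k (G0 P a msq k μ) J α ζ) (opHS P k (G0 P a msq k μ) J α ζ) else (0 : ℝ)) ≤ R
    split_ifs with hα
    swap
    · exact hR0
    refine max_le ?_ ?_
    · -- ‖ζ∇G₀J‖_α: subadditivity only
      refine opHD_le _ J α ζ fun lam ν => ?_
      have hfun : (fun x => ζ x * opKD P k (G0 P a msq k μ) lam (J ν) x) = fun x =>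
          ζ x * ED P a msq k lam (J ν) x + ∑ y'' : Site P k, ζ x * ED P a msq k lam (pieceV P a msq k μ 0 J y'' ν) x := by
        funext x; rw [opKD_G0_eq ha hm hk1 hk μ, mul_add, Finset.mul_sum]
      rw [hfun, hR]
      refine (holN_add_le k α _ _).trans (add_le_add ?_ ((holN_sum_le k α _ _).trans (Finset.sum_le_sum fun y'' _ => ?_)))
      · refine le_trans ?_ (le_max_left _ _)
        exact Finset.le_sup' (fun p : Fin P.d × Fin P.d => holN P k α (fun x => ζ x * ED P a msq k p.1 (J p.2) x))
          (Finset.mem_univ (lam, ν))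
      · refine le_trans ?_ (le_add_of_nonneg_right (hDterm y''))
        refine le_trans ?_ (le_max_left _ _)
        exact Finset.le_sup' (fun p : Fin P.d × Fin P.d =>
          holN P k α (fun x => ζ x * ED P a msq k p.1 (pieceV P a msq k μ 0 J y'' p.2) x)) (Finset.mem_univ (lam, ν))
    · -- ‖ζG₀∇*J‖_α: subadditivity + the product rule with the mean-value step on each piece
      show holN P k α (fun x => ζ x * opDiv P k (G0 P a msq k μ) J x) ≤ R
      have hfun : (fun x => ζ x * opDiv P k (G0 P a msq k μ) J x) = fun x =>
          ζ x * gDiv P a msq k J x + ∑ y'' : Site P k, ζ x * E0 P a msq k (pieceV P a msq k μ 2 J y'' (dir0 P)) x := by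
        funext x; rw [opDiv_G0_eq ha hm hk1 hk μ, mul_add, Finset.mul_sum]
      rw [hfun, hR]
      refine (holN_add_le k α _ _).trans (add_le_add (le_max_right _ _) ((holN_sum_le k α _ _).trans
        (Finset.sum_le_sum fun y'' _ => ?_)))
      refine le_trans ?_ (le_add_of_nonneg_left (h1_nonneg' o _ α ζ))
      -- the piece u = G′(piece₂(y″)) and its sup data near y
      set M₀ := ∑ w ∈ B5TorusCover.nbrOf (T P k) 6 y, (gpSetting P a msq k o).e 0 (pieceV P a msq k μ 2 J y'') w with hM₀
      set M₁ := ∑ w ∈ B5TorusCover.nbrOf (T P k) 6 y, (gpSetting P a msq k o).e 1 (pieceV P a msq k μ 2 J y'') w with hM₁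
      have hM₀0 : 0 ≤ M₀ := Finset.sum_nonneg fun w _ => e0_nonneg' o _ w
      have hM₁0 : 0 ≤ M₁ := Finset.sum_nonneg fun w _ => e1_nonneg' o _ w
      have h0 : ∀ w, T P 0 w (fine P k y) ≤ 3 * (P.L : ℝ) ^ k →
          |E0 P a msq k (pieceV P a msq k μ 2 J y'' (dir0 P)) w| ≤ M₀ := by
        intro w hw
        have hmem := proj_mem_nbrOf hk hw
        refine le_trans ?_ (Finset.single_le_sum (f := fun w' => (gpSetting P a msq k o).e 0 (pieceV P a msq k μ 2 J y'') w')
          (fun w' _ => e0_nonneg' o _ w') hmem)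
        exact le_cubeSup (dir0 P) (fun ν => E0 P a msq k (pieceV P a msq k μ 2 J y'' ν)) (dir0 P) (inCube_proj hk w)
      have h1' : ∀ w μ', T P 0 w (fine P k y) ≤ 3 * (P.L : ℝ) ^ k →
          |(dEta P k μ' *ᵥ (fun z => E0 P a msq k (pieceV P a msq k μ 2 J y'' (dir0 P)) z)) w| ≤ M₁ := by
        intro w μ' hw
        have hmem := proj_mem_nbrOf hk hw
        have hfn : (fun z => E0 P a msq k (pieceV P a msq k μ 2 J y'' (dir0 P)) z) =
            Grs P a msq k *ᵥ pieceV P a msq k μ 2 J y'' (dir0 P) := by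
          funext z; rw [B5Display135Torus.E0_eq ha hm hk1]
        rw [hfn, Matrix.mulVec_mulVec, ← ED_eq' ha hm hk1]
        refine le_trans ?_ (Finset.single_le_sum (f := fun w' => (gpSetting P a msq k o).e 1 (pieceV P a msq k μ 2 J y'') w')
          (fun w' _ => e1_nonneg' o _ w') hmem)
        exact le_cubeSup (dir0 P, dir0 P)
          (fun p : Fin P.d × Fin P.d => ED P a msq k p.1 (pieceV P a msq k μ 2 J y'' p.2)) (μ', dir0 P) (inCube_proj hk w)
      have hmv := holN_cut_mul_le (k := k) hα ζ (fun z => E0 P a msq k (pieceV P a msq k μ 2 J y'' (dir0 P)) z) hζ hM₀0 hM₁0 h0 h1'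
      refine hmv.trans ?_
      rw [Finset.sum_add_distrib, ← hM₀, ← hM₁]
      have hc : 0 ≤ cutHV P k α ζ := cutHV_nonneg k α ζ
      have hd0 : (0 : ℝ) ≤ P.d := Nat.cast_nonneg _
      calc cutHV P k α ζ * (M₀ + P.d * M₁) ≤ cutHV P k α ζ * ((P.d + 1) * (M₀ + M₁)) := by
            refine mul_le_mul_of_nonneg_left ?_ hc
            nlinarith
        _ ≤ cutHV P k α ζ * (Dh * (M₀ + M₁)) :=
            mul_le_mul_of_nonneg_left (mul_le_mul_of_nonneg_right hDh (add_nonneg hM₀0 hM₁0)) hc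
        _ = Dh * cutHV P k α ζ * (M₀ + M₁) := by ring

end Display

/-! ## §6 The transfer and Proposition 1.2 for G₀ on the torus -/

section Family

variable (d L : ℕ) (hd : 1 ≤ d) (hL : Odd L ∧ 1 < L) {a msq : ℝ} (ha : 0 < a) (hm : 0 ≤ msq)
  {I : Type} (Pf : I → Params) (hPd : ∀ i, (Pf i).d = d) (hPL : ∀ i, (Pf i).L = L) (hK : ∀ i, 1 ≤ (Pf i).K)
  (μI : ∀ i, Fin (Pf i).d) (oI : ∀ i, L2Half (Pf i))

include ha hm hPd hK in
/-- **THE HYPOTHESIS `transfer` OF S3, DISCHARGED on the torus**: for any top-level family of tori (P.d = d, K ≥ 1) and directions,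
(1.110)–(1.111) and (1.112)–(1.113) for G′_K together with (1.114) for G₀ imply (1.110)–(1.113) for G₀ —
`B5Transfer133.transfer_of_display133` with every located leaf (`CarrierFacts`, `Display133`, `URow`) PROVED for the concrete
carrier, family-uniform constants A = 2a, B = d·3^d, r0 = 6, Nn = 13^d, Dh = d + 1, Λ(κ) = K_d(κ).
[cite: Balaban1984PropagatorsI, (1.133) p.39 («easily reduced to the corresponding properties of the operator G′»)] -/
theorem transfer_torus :
    FirstOrderFam (fun i => gpSetting (Pf i) a msq (Pf i).K (oI i)) →
      SecondOrderFam (fun i => gpSetting (Pf i) a msq (Pf i).K (oI i)) →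
        B5.Local114Fam (famG0 Pf μI a msq) →
          FirstOrderFam (famG0 Pf μI a msq) ∧ SecondOrderFam (famG0 Pf μI a msq) :=
  B5Transfer133.transfer_of_display133 (fun i => gpSetting (Pf i) a msq (Pf i).K (oI i)) (famG0 Pf μI a msq)
    (fun i => carrier (Pf i) a msq (Pf i).K (μI i) (oI i))
    (A := 2 * a) (B := d * 3 ^ d) (r0 := 6) (Nn := 13 ^ d) (Dh := d + 1)
    (fun i => carrierFacts ha (hK i) (Nat.le_add_left _ _) (μI i) (oI i) (by rw [hPd i]) (by rw [hPd i]))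
    (fun i => display133 ha hm (hK i) (Nat.le_add_left _ _) (μI i) (oI i) (by rw [hPd i]))
    (fun i => modelSigns_gpSetting a msq (Pf i).K (oI i)) (fun i => modelSigns_g0Setting a msq (Pf i).K (μI i))
    (fun κ hκ => ⟨B4Sect5Proof.latticeConst d κ, fun i => by
      rw [← hPd i]; exact uRow (μ := μI i) (o := oI i) hκ⟩)

include hd hL ha hm hPd hPL hK in
/-- **PROPOSITION 1.2 FOR G₀ ON THE TORUS from «Proposition 1.1 for G₀» and «(1.114) for G₀» ALONE**: for the G₀-family of
record over any top-level family of tori and directions, `B5.Prop12Printed` follows from the two printed sentences of p. 39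
about G₀ (`h11G0`, `h114G0`) — (1.110)–(1.113) for G′_K are THEOREMS (`B5Prop12GpTorus.gp_blocks_top'`, from [2]'s Theorem
and Lemma 2.4 on the torus) and the (1.133)-transfer is `transfer_torus`.
[cite: Balaban1984PropagatorsI, Prop. 1.2 (1.110)–(1.114) pp.35–36, (1.133)–(1.134) p.39] -/
theorem prop12G0_torus (h11G0 : B5.Prop11Printed (famG0 Pf μI a msq))
    (h114G0 : B5.Prop11Printed (famG0 Pf μI a msq) → B5.Local114Fam (famG0 Pf μI a msq)) :
    B5.Prop12Printed (famG0 Pf μI a msq) :=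
  B5Prop12GpTorus.prop12G0_of_torusGp' d L hd hL ha hm Pf hPd hPL hK (fun i => L2Half.trivial (Pf i))
    (famG0 Pf μI a msq) (fun i => modelSigns_g0Setting a msq (Pf i).K (μI i)) h11G0 h114G0
    (transfer_torus d ha hm Pf hPd hK μI fun i => L2Half.trivial (Pf i))

include hd hL ha hm in
/-- **The same for the family of record `famG0Top d L a m²`** (all tori with P.d = d, P.L = L, K ≥ 1, all directions).
[cite: Balaban1984PropagatorsI, Prop. 1.2 pp.35–36, (1.133) p.39] -/
theorem prop12G0_torus_top (h11G0 : B5.Prop11Printed (famG0Top d L a msq))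
    (h114G0 : B5.Prop11Printed (famG0Top d L a msq) → B5.Local114Fam (famG0Top d L a msq)) :
    B5.Prop12Printed (famG0Top d L a msq) := by
  rw [famG0Top_eq] at *
  exact prop12G0_torus d L hd hL ha hm (fun i : G0TopIdx d L => i.P) (fun i : G0TopIdx d L => i.hPd)
    (fun i : G0TopIdx d L => i.hPL) (fun i : G0TopIdx d L => i.hK) (fun i : G0TopIdx d L => i.μ) h11G0 h114G0

end Family

end B5Display133G0Torus

end

end Literature.MathematicalPhysics.QuantumFieldTheory.Balaban1983to89
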